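import Summits.ValiantsHypothesis.ValiantsHypothesis.Theorems.BarrierLeverAnchoredDoorHitsLowerPairsStarSpec

/-!
# Support item `AnchoredDoorHitsLowerPairs` (stmt-ValiantsHypothesis-22510), line `anchored-peeling`:
# the SYMBOLIC SPLIT IDENTITY, part 1: coefficient calculus and the split specialisation

Helper file (`--supports stmt-ValiantsHypothesis-22510`; cell valiant-natproofs, rung V4, 𝒟-side door (c); prover seat val-np-p1 gen 15;
memo HOME/val-np-p1/g15/STARSTEP-RIGID-MEMO-valnp1-g15.md §2.4 (i)). Closes NO item.

THE IDENTITY (`symbolicDet_ne_zero_of_splitMatrix`). Fix an `x`-vertex `a`, a `y`-vertex `c` and a set `D ∌ c` of `y`-vertices. Specialise the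
parameters of the anchored door 𝔄_s (`splitSpec`): the vertex–vertex anchor `({a}|{c})` gets `θ ↦ 1`, the anchors `({a}|{d})`, `d ∈ D`,
KEEP their `θ` (all twists of these anchors `↦ 0`); every other anchor whose `x`-part contains `a` or whose `y`-part contains `c` is
killed (`θ ↦ 0`); every twist on the variables `x_a`, `y_c` is killed; everything else is unchanged. The specialised witness is
`(1 + x_a (y_c + Σ_{d ∈ D} θ_{(a|d)} y_d)) · F₀` with `F₀` free of `x_a, y_c` and agreeing with the full symbolic witness on all monomials
avoiding `x_a, y_c` (`AgreeOff`, `Avoids` calculus). Hence the specialised layout matrix is the SPLIT MATRIX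
`M[i,j] = [a ∉ u i][c ∉ w j] · L[u i, w j] + [a ∈ u i] · ([c ∈ w j] · L[u i ∖ a, w j ∖ c] + [c ∉ w j] · Σ_{d ∈ D ∩ w j} θ_{(a|d)} · L[u i ∖ a, w j ∖ d])`
(`L` = the full symbolic layout), i.e. the block matrix `[[X, 0], [Q, Y]]` of the memo (rows `a ∉ S` / `a ∈ S`, columns `c ∉ T` / `c ∈ T`),
and `det M ≠ 0 ⇒ symbolicDet s h r u w ≠ 0`. When the two stars have equal size this is the star(1) step; otherwise `det M ≠ 0` is exactly
the DEFECT-TRANSFER condition (i)–(iii) of the memo, now a single polynomial non-vanishing in the line's language — the entry point for a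
relative-Lefschetz argument on `stub_rigidPairs`.

THIS FILE (part 1): the coefficient calculi `AgreeOff` (same coefficients off `x_a, y_c`) and `Avoids` (no monomial with `x_a` or
`y_c`), both multiplicative; the specialisation `splitSpec`/`splitHom`; the three kinds of specialised anchor factors
(`avoids_map_splitHom_symbFactor`, `agreeOff_map_splitHom_symbFactor` for anchors not meeting `a, c`; `map_splitHom_symbFactor_of_meet` =
`1 + x_a · splitLin` for anchors meeting them); `∏ (1 + x_a L_i) = 1 + x_a Σ L_i + x_a² J` (`prod_one_add_X_mul`) and square-free
exponents ignore `x_a²` (`coeff_pexpo_X_sq_mul`). Part 2 (`…SplitIdentity`) assembles the identity.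

WHAT THIS IS NOT: an identity, not a step theorem — nothing here proves `det M ≠ 0` for any pair; nothing on items 22510 / 19717
themselves, on crux stmt-ValiantsHypothesis-14610, or on `VP` versus `VNP`.
-/

set_option linter.dupNamespace false

namespace Summit.ValiantsHypothesis.ValiantsHypothesis.Theorems.BarrierLever.AnchoredPeeling

open Finset MvPolynomial
open Summit.ValiantsHypothesis.ValiantsHypothesis.Theorems.BarrierLever.BrickCalculus
  (pexpo pexpo_def pexpo_le_iff pexpo_sub pexpo_apply_castAdd pexpo_apply_natAdd)
open Summit.ValiantsHypothesis.ValiantsHypothesis.Theorems.BarrierLever.ProductStateSums (castAdd_ne_natAdd)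

noncomputable section

variable {h : ℕ}

/-! ## 1. Two coefficient calculi: agreement off `{x_a, y_c}`, and avoidance of `{x_a, y_c}` -/

section Calculus

variable {R : Type*} [CommSemiring R] (a c : Fin h)

/-- `g` and `g'` have the same coefficients on monomials avoiding `x_a` and `y_c`. -/
def AgreeOff (g g' : MvPolynomial (Fin (h + h)) R) : Prop :=
  ∀ m : Fin (h + h) →₀ ℕ, m (Fin.castAdd h a) = 0 → m (Fin.natAdd h c) = 0 → coeff m g = coeff m g'

/-- `g` has no monomial containing `x_a` or `y_c`. -/
def Avoids (g : MvPolynomial (Fin (h + h)) R) : Prop :=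
  ∀ m : Fin (h + h) →₀ ℕ, (m (Fin.castAdd h a) ≠ 0 ∨ m (Fin.natAdd h c) ≠ 0) → coeff m g = 0

variable {a c}

/-- Agreement is multiplicative. -/
theorem AgreeOff.mul {g₁ g₁' g₂ g₂' : MvPolynomial (Fin (h + h)) R} (h₁ : AgreeOff a c g₁ g₁') (h₂ : AgreeOff a c g₂ g₂') :
    AgreeOff a c (g₁ * g₂) (g₁' * g₂') := by
  classical
  intro m hma hmc
  rw [coeff_mul, coeff_mul]
  refine Finset.sum_congr rfl (fun x hx => ?_)
  have hx' : x.1 + x.2 = m := Finset.HasAntidiagonal.mem_antidiagonal.mp hx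
  have e1 : x.1 (Fin.castAdd h a) + x.2 (Fin.castAdd h a) = 0 := by rw [← Finsupp.add_apply, hx', hma]
  have e2 : x.1 (Fin.natAdd h c) + x.2 (Fin.natAdd h c) = 0 := by rw [← Finsupp.add_apply, hx', hmc]
  rw [h₁ x.1 (by omega) (by omega), h₂ x.2 (by omega) (by omega)]

/-- Agreement over finite products. -/
theorem AgreeOff.prod {ι : Type*} (s : Finset ι) {g g' : ι → MvPolynomial (Fin (h + h)) R}
    (hg : ∀ i ∈ s, AgreeOff a c (g i) (g' i)) : AgreeOff a c (∏ i ∈ s, g i) (∏ i ∈ s, g' i) := by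
  classical
  induction s using Finset.induction_on with
  | empty => intro m _ _; simp
  | insert i s hi ih =>
    rw [Finset.prod_insert hi, Finset.prod_insert hi]
    exact AgreeOff.mul (hg i (Finset.mem_insert_self i s)) (ih fun j hj => hg j (Finset.mem_insert_of_mem hj))

/-- Agreement is reflexive. -/
theorem AgreeOff.refl (g : MvPolynomial (Fin (h + h)) R) : AgreeOff a c g g := fun _ _ _ => rfl

/-- Agreement is additive. -/
theorem AgreeOff.add {g₁ g₁' g₂ g₂' : MvPolynomial (Fin (h + h)) R} (h₁ : AgreeOff a c g₁ g₁') (h₂ : AgreeOff a c g₂ g₂') :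
    AgreeOff a c (g₁ + g₂) (g₁' + g₂') := by
  intro m hma hmc
  rw [coeff_add, coeff_add, h₁ m hma hmc, h₂ m hma hmc]

/-- Avoidance is multiplicative. -/
theorem Avoids.mul {g₁ g₂ : MvPolynomial (Fin (h + h)) R} (h₁ : Avoids a c g₁) (h₂ : Avoids a c g₂) :
    Avoids a c (g₁ * g₂) := by
  classical
  intro m hm
  rw [coeff_mul]
  refine Finset.sum_eq_zero (fun x hx => ?_)
  have hx' : x.1 + x.2 = m := Finset.HasAntidiagonal.mem_antidiagonal.mp hx
  have e1 : x.1 (Fin.castAdd h a) + x.2 (Fin.castAdd h a) = m (Fin.castAdd h a) := by rw [← Finsupp.add_apply, hx']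
  have e2 : x.1 (Fin.natAdd h c) + x.2 (Fin.natAdd h c) = m (Fin.natAdd h c) := by rw [← Finsupp.add_apply, hx']
  by_cases hx1 : x.1 (Fin.castAdd h a) ≠ 0 ∨ x.1 (Fin.natAdd h c) ≠ 0
  · rw [h₁ x.1 hx1, zero_mul]
  · have hx2 : x.2 (Fin.castAdd h a) ≠ 0 ∨ x.2 (Fin.natAdd h c) ≠ 0 := by
      simp only [not_or, not_not] at hx1
      rcases hm with hm | hm
      · left; omega
      · right; omega
    rw [h₂ x.2 hx2, mul_zero]

/-- Avoidance over finite products. -/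
theorem Avoids.prod {ι : Type*} (s : Finset ι) {g : ι → MvPolynomial (Fin (h + h)) R}
    (hg : ∀ i ∈ s, Avoids a c (g i)) : Avoids a c (∏ i ∈ s, g i) := by
  classical
  induction s using Finset.induction_on with
  | empty =>
    intro m hm
    rw [Finset.prod_empty, coeff_one, if_neg]
    rintro rfl
    simp at hm
  | insert i s hi ih =>
    rw [Finset.prod_insert hi]
    exact Avoids.mul (hg i (Finset.mem_insert_self i s)) (ih fun j hj => hg j (Finset.mem_insert_of_mem hj))

/-- `1` avoids. -/
theorem Avoids.one : Avoids a c (1 : MvPolynomial (Fin (h + h)) R) := by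
  simpa using Avoids.prod (R := R) (a := a) (c := c) (∅ : Finset ℕ) (g := fun _ => 1) (by simp)

/-- Constants avoid. -/
theorem Avoids.C (r : R) : Avoids a c (MvPolynomial.C r : MvPolynomial (Fin (h + h)) R) := by
  classical
  intro m hm
  rw [coeff_C, if_neg]
  rintro rfl
  simp at hm

/-- A variable other than `x_a, y_c` avoids. -/
theorem Avoids.X {v : Fin (h + h)} (hva : v ≠ Fin.castAdd h a) (hvc : v ≠ Fin.natAdd h c) :
    Avoids a c (MvPolynomial.X v : MvPolynomial (Fin (h + h)) R) := by
  classical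
  intro m hm
  rw [coeff_X, if_neg]
  rintro rfl
  rw [Finsupp.single_apply, Finsupp.single_apply, if_neg hva, if_neg hvc] at hm
  simp at hm

/-- Sums of avoiding polynomials avoid. -/
theorem Avoids.add {g₁ g₂ : MvPolynomial (Fin (h + h)) R} (h₁ : Avoids a c g₁) (h₂ : Avoids a c g₂) :
    Avoids a c (g₁ + g₂) := by
  intro m hm; rw [coeff_add, h₁ m hm, h₂ m hm, add_zero]

end Calculus

/-! ## 2. The split specialisation -/

/-- The split specialisation at `(a, c, D)`: `θ_{({a}|{c})} ↦ 1`; `θ_{({a}|{d})}` kept for `d ∈ D`; every other anchor meeting `a` or `c`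
killed; twists of the kept vertex anchors killed; every twist on `x_a` / `y_c` killed; everything else unchanged. -/
def splitSpec (a c : Fin h) (D : Finset (Fin h)) : Param h → MvPolynomial (Param h) ℂ
  | Sum.inl α =>
      if α = ({a}, {c}) then 1
      else if α.1 = {a} ∧ (∃ d ∈ D, α.2 = {d}) then X (Sum.inl α)
      else if a ∈ α.1 ∨ c ∈ α.2 then 0 else X (Sum.inl α)
  | Sum.inr (Sum.inl (α, b)) => if a ∈ α.1 ∨ c ∈ α.2 ∨ b = a then 0 else X (Sum.inr (Sum.inl (α, b)))
  | Sum.inr (Sum.inr (α, e)) => if a ∈ α.1 ∨ c ∈ α.2 ∨ e = c then 0 else X (Sum.inr (Sum.inr (α, e)))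

/-- The split specialisation as a ring endomorphism of `ℂ[θ, φ, ψ]`. -/
def splitHom (a c : Fin h) (D : Finset (Fin h)) : MvPolynomial (Param h) ℂ →+* MvPolynomial (Param h) ℂ :=
  (aeval (splitSpec a c D)).toRingHom

/-- The split specialisation on a parameter variable. -/
theorem splitHom_X (a c : Fin h) (D : Finset (Fin h)) (v : Param h) : splitHom a c D (X v) = splitSpec a c D v := by
  rw [splitHom, AlgHom.toRingHom_eq_coe, RingHom.coe_coe, aeval_X]

section Factors

variable (s : ℕ) (a c : Fin h) (D : Finset (Fin h)) (hcD : c ∉ D)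

/-- Anchors not meeting `a`, `c`: the specialised factor avoids `x_a, y_c` … -/
theorem avoids_map_splitHom_symbFactor {α : Finset (Fin h) × Finset (Fin h)} (ha : a ∉ α.1) (hc : c ∉ α.2) :
    Avoids a c (MvPolynomial.map (splitHom a c D) (symbFactor h α)) := by
  classical
  rw [symbFactor]
  simp only [map_add, map_one, map_mul, map_prod, map_C, map_X, splitHom_X]
  refine Avoids.add Avoids.one ?_
  refine Avoids.mul (Avoids.mul (Avoids.mul (Avoids.mul (Avoids.C _) ?_) ?_) ?_) ?_
  · exact Avoids.prod _ (fun b hb => Avoids.X (fun h' => ha (by rwa [Fin.castAdd_injective _ _ h'] at hb))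
      (castAdd_ne_natAdd _ _))  -- castAdd b ≠ natAdd c
  · exact Avoids.prod _ (fun e he => Avoids.X (fun h' => castAdd_ne_natAdd _ _ h'.symm)
      (fun h' => hc (by rwa [(Fin.natAdd_inj _).mp h'] at he)))
  · refine Avoids.prod _ (fun b _ => ?_)
    by_cases hb : b = a
    · subst hb
      simp only [splitSpec, or_true, ↓reduceIte, map_zero, zero_mul, add_zero]
      exact Avoids.one
    · exact Avoids.add Avoids.one (Avoids.mul (Avoids.C _) (Avoids.X (fun h' => hb (Fin.castAdd_injective _ _ h'))
        (castAdd_ne_natAdd _ _)))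
  · refine Avoids.prod _ (fun e _ => ?_)
    by_cases he : e = c
    · subst he
      simp only [splitSpec, or_true, ↓reduceIte, map_zero, zero_mul, add_zero]
      exact Avoids.one
    · exact Avoids.add Avoids.one (Avoids.mul (Avoids.C _) (Avoids.X (fun h' => castAdd_ne_natAdd _ _ h'.symm)
        (fun h' => he ((Fin.natAdd_inj _).mp h'))))

end Factors


section More

variable (s : ℕ) (a c : Fin h) (D : Finset (Fin h))

/-- A factor whose anchor meets `a` or `c` agrees with `1` off `{x_a, y_c}` (all its other monomials contain `x^A y^B`). -/
theorem agreeOff_one_symbFactor {α : Finset (Fin h) × Finset (Fin h)} (hmeet : a ∈ α.1 ∨ c ∈ α.2)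
    (g : MvPolynomial (Fin (h + h)) (MvPolynomial (Param h) ℂ)) :
    AgreeOff a c (1 : MvPolynomial (Fin (h + h)) (MvPolynomial (Param h) ℂ)) (1 + monomial (pexpo α.1 α.2) 1 * g) := by
  classical
  intro m hma hmc
  rw [coeff_add, coeff_monomial_mul', if_neg, add_zero]
  intro hle
  rcases hmeet with ha | hc
  · have := hle (Fin.castAdd h a)
    rw [pexpo_apply_castAdd, if_pos ha, hma] at this
    exact Nat.not_succ_le_zero 0 this
  · have := hle (Fin.natAdd h c)
    rw [pexpo_apply_natAdd, if_pos hc, hmc] at this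
    exact Nat.not_succ_le_zero 0 this

/-- The twist at a killed variable agrees with the original twist off `{x_a, y_c}`. -/
theorem agreeOff_twist {R : Type*} [CommSemiring R] (p q : R) {v : Fin (h + h)}
    (hv : v = Fin.castAdd h a ∨ v = Fin.natAdd h c) :
    AgreeOff a c (1 + MvPolynomial.C p * X v : MvPolynomial (Fin (h + h)) R) (1 + MvPolynomial.C q * X v) := by
  classical
  intro m hma hmc
  have hm : ¬ Finsupp.single v 1 = m := by
    rintro rfl
    rcases hv with rfl | rfl
    · simp at hma
    · simp at hmc
  rw [coeff_add, coeff_add, coeff_C_mul, coeff_C_mul, coeff_X, if_neg hm, mul_zero, mul_zero]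

/-- Anchors not meeting `a`, `c`: the specialised factor agrees with the original off `{x_a, y_c}`. -/
theorem agreeOff_map_splitHom_symbFactor {α : Finset (Fin h) × Finset (Fin h)} (ha : a ∉ α.1) (hc : c ∉ α.2) :
    AgreeOff a c (MvPolynomial.map (splitHom a c D) (symbFactor h α)) (symbFactor h α) := by
  classical
  have h1 : ¬ α = ({a}, {c}) := by rintro rfl; exact ha (Finset.mem_singleton_self a)
  have h2 : ¬ (α.1 = {a} ∧ ∃ d ∈ D, α.2 = {d}) := by
    rintro ⟨h', -⟩; exact ha (by rw [h']; exact Finset.mem_singleton_self a)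
  have h3 : ¬ (a ∈ α.1 ∨ c ∈ α.2) := fun h' => h'.elim ha hc
  have hθ : splitHom a c D (X (Sum.inl α)) = X (Sum.inl α) := by
    rw [splitHom_X, splitSpec, if_neg h1, if_neg h2, if_neg h3]
  rw [symbFactor]
  simp only [map_add, map_one, map_mul, map_prod, map_C, map_X, hθ, splitHom_X]
  refine AgreeOff.add (AgreeOff.refl _) (AgreeOff.mul (AgreeOff.mul (AgreeOff.refl _) ?_) ?_)
  · refine AgreeOff.prod _ (fun b _ => ?_)
    by_cases hb : b = a
    · rw [hb]; exact agreeOff_twist a c _ _ (Or.inl rfl)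
    · have : splitSpec a c D (Sum.inr (Sum.inl (α, b))) = X (Sum.inr (Sum.inl (α, b))) := by
        rw [splitSpec, if_neg]; push Not; exact ⟨ha, hc, hb⟩
      rw [this]; exact AgreeOff.refl _
  · refine AgreeOff.prod _ (fun e _ => ?_)
    by_cases he : e = c
    · rw [he]; exact agreeOff_twist a c _ _ (Or.inr rfl)
    · have : splitSpec a c D (Sum.inr (Sum.inr (α, e))) = X (Sum.inr (Sum.inr (α, e))) := by
        rw [splitSpec, if_neg]; push Not; exact ⟨ha, hc, he⟩
      rw [this]; exact AgreeOff.refl _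

/-- The `x_a`-linear part attached to an anchor meeting `a` or `c`: `y_c` for `({a}|{c})`, `θ_{({a}|{d})} y_d` for `d ∈ D`, else `0`. -/
def splitLin (a c : Fin h) (D : Finset (Fin h)) (α : Finset (Fin h) × Finset (Fin h)) :
    MvPolynomial (Fin (h + h)) (MvPolynomial (Param h) ℂ) :=
  (if α = ({a}, {c}) then X (Fin.natAdd h c) else 0) +
    ∑ d ∈ D, (if α = ({a}, {d}) then C (X (Sum.inl α)) * X (Fin.natAdd h d) else 0)

/-- Anchors meeting `a` or `c`: the specialised factor is `1 + x_a · splitLin`. -/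
theorem map_splitHom_symbFactor_of_meet (hcD : c ∉ D) {α : Finset (Fin h) × Finset (Fin h)}
    (hmeet : a ∈ α.1 ∨ c ∈ α.2) :
    MvPolynomial.map (splitHom a c D) (symbFactor h α) = 1 + X (Fin.castAdd h a) * splitLin a c D α := by
  classical
  -- all twists of a meeting anchor die
  have htw : ∀ b, splitSpec a c D (Sum.inr (Sum.inl (α, b))) = 0 := fun b => by
    rw [splitSpec, if_pos]; rcases hmeet with h' | h'; exact Or.inl h'; exact Or.inr (Or.inl h')
  have htw' : ∀ e, splitSpec a c D (Sum.inr (Sum.inr (α, e))) = 0 := fun e => by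
    rw [splitSpec, if_pos]; rcases hmeet with h' | h'; exact Or.inl h'; exact Or.inr (Or.inl h')
  rw [symbFactor]
  simp only [map_add, map_one, map_mul, map_prod, map_C, map_X, splitHom_X, htw, htw', map_zero, zero_mul, add_zero,
    Finset.prod_const_one, mul_one]
  by_cases h0 : α = ({a}, {c})
  · subst h0
    have hD : ∑ d ∈ D, (if (({a}, {c}) : Finset (Fin h) × Finset (Fin h)) = ({a}, {d}) then
        C (X (Sum.inl (({a}, {c}) : Finset (Fin h) × Finset (Fin h)))) * X (Fin.natAdd h d) else 0 :
        MvPolynomial (Fin (h + h)) (MvPolynomial (Param h) ℂ)) = 0 := by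
      refine Finset.sum_eq_zero (fun d hd => if_neg (fun h' => hcD ?_))
      have := Finset.singleton_injective (congrArg Prod.snd h')
      rwa [this]
    rw [splitLin, if_pos rfl, hD, add_zero, splitSpec, if_pos rfl]
    simp only [Finset.prod_singleton, map_one, one_mul]
  by_cases h1 : α.1 = {a} ∧ ∃ d ∈ D, α.2 = {d}
  · obtain ⟨hA, d, hd, hB⟩ := h1
    have hα : α = ({a}, {d}) := Prod.ext hA hB
    subst hα
    have hsum : ∑ d' ∈ D, (if (({a}, {d}) : Finset (Fin h) × Finset (Fin h)) = ({a}, {d'}) then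
        C (X (Sum.inl (({a}, {d}) : Finset (Fin h) × Finset (Fin h)))) * X (Fin.natAdd h d') else 0 :
        MvPolynomial (Fin (h + h)) (MvPolynomial (Param h) ℂ)) = C (X (Sum.inl ({a}, {d}))) * X (Fin.natAdd h d) := by
      rw [Finset.sum_eq_single d]
      · rw [if_pos rfl]
      · intro d' _ hd'
        exact if_neg (fun h' => hd' (Finset.singleton_injective (congrArg Prod.snd h')).symm)
      · exact fun h' => absurd hd h'
    rw [splitLin, if_neg h0, zero_add, hsum, splitSpec, if_neg h0, if_pos ⟨rfl, d, hd, rfl⟩]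
    simp only [Finset.prod_singleton]
    ring
  · have hθ : splitSpec a c D (Sum.inl α) = 0 := by rw [splitSpec, if_neg h0, if_neg h1, if_pos hmeet]
    have hL : splitLin a c D α = 0 := by
      rw [splitLin, if_neg h0, zero_add]
      refine Finset.sum_eq_zero (fun d hd => if_neg (fun h' => h1 ?_))
      subst h'
      exact ⟨rfl, d, hd, rfl⟩
    rw [hθ, hL, map_zero, zero_mul, zero_mul, add_zero, mul_zero, add_zero]

/-- A product of factors `1 + x_a L_i` is `1 + x_a Σ L_i` up to a multiple of `x_a²`. -/
theorem prod_one_add_X_mul {R : Type*} [CommSemiring R] {ι : Type*} (t : Finset ι) (v : Fin (h + h))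
    (L : ι → MvPolynomial (Fin (h + h)) R) :
    ∃ J : MvPolynomial (Fin (h + h)) R, ∏ i ∈ t, (1 + X v * L i) = 1 + X v * ∑ i ∈ t, L i + X v ^ 2 * J := by
  classical
  induction t using Finset.induction_on with
  | empty => exact ⟨0, by simp⟩
  | insert i t hi ih =>
    obtain ⟨J, hJ⟩ := ih
    refine ⟨L i * (∑ j ∈ t, L j) + J + X v * L i * J, ?_⟩
    rw [Finset.prod_insert hi, Finset.sum_insert hi, hJ]
    ring

/-- Square-free exponents have entries `≤ 1`. -/
theorem pexpo_apply_le_one (S T : Finset (Fin h)) (v : Fin (h + h)) : pexpo S T v ≤ 1 := by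
  refine Fin.addCases (motive := fun v => pexpo S T v ≤ 1) (fun a' => ?_) (fun c' => ?_) v
  · rw [pexpo_apply_castAdd]; split_ifs <;> omega
  · rw [pexpo_apply_natAdd]; split_ifs <;> omega

/-- Square-free exponents do not see multiples of `x_v²`. -/
theorem coeff_pexpo_X_sq_mul {R : Type*} [CommSemiring R] (S T : Finset (Fin h)) (v : Fin (h + h))
    (g : MvPolynomial (Fin (h + h)) R) : coeff (pexpo S T) (X v ^ 2 * g) = 0 := by
  classical
  rw [pow_two, mul_assoc, coeff_X_mul']
  split_ifs with h1
  · rw [coeff_X_mul', if_neg]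
    rw [Finsupp.mem_support_iff, Finsupp.tsub_apply, Finsupp.single_eq_same, not_not]
    have := pexpo_apply_le_one S T v
    omega
  · rfl

end More

end

end Summit.ValiantsHypothesis.ValiantsHypothesis.Theorems.BarrierLever.AnchoredPeeling
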